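import Mathlib
import HarnessLib
import HarnessLib.Audit
import Summits.CriticalPhenomena.Statement
import Literature.Probability.RandomPlanarGeometry.RestrictionHulls
import Literature.Probability.RandomPlanarGeometry.ConformalRectangle
import HarnessLib.Audit.Status.Attr

/-!
Route: SAWChargeContinuation

DORMANT since 2026-08-22T07:36:46Z (reconciler: no traction for 5.2 d (last activity item-evidence-added at 2026-08-17T02:52:06Z); parked, not closed — `ledger route dormant route-CriticalPhenomena-SAWChargeContinuation --off` to reacti) — unstaffed, not closed; items shared with open routes are served there. `ledger route dormant <id> --off` reactivates.

# Route SAWChargeContinuation — SAW avoidance law by analytic continuation in the loop-soup charge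
from the LERW free-fermion point

It suffices to show X = (A0) ∧ (T) ∧ (S) (card charge-continuation-from-lerw-lambda-saw, which also
absorbs the retired
lambda-flow-from-lerw). (A0) SAWAvoidanceLaw: for every Dobrushin domain D, hull subdomain D′
(MarkedDomain.IsHullSubdomain:
D ∖ D′ away from a, b), endpoint approximation and chordal uniformizer φ with restriction data (Φ_A,
d = Φ_A′(0)) of
A = φ.pullbackHull D′, the probability that the critical δℤ² SAW from a_δ to b_δ in D_δ uses only
vertices of D′ and edges
inside cl D′ converges to d^(5/8) (the SLE_8/3 restriction formula, LSW03 Thm 6.1). (T)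
EventualTight: the SAW laws are
tight for δ ∈ (0, δ₀]. (S) SubseqSimple: every subsequential weak limit is carried by chordal simple
curves (chordalCarrier D).
The card's MECHANISM for (A0) is the pair of cruxes (P) WindowAvoidanceLaw and (U) ChargeAnalyticity
on the Kozdron–Lawler
λ-SAW homotopy s ∈ [0,1] (weights y^|γ| e^(s·m(γ)), m = random-walk loop measure; s = 1 LERW, s = 0
SAW), glued by Vitali
(support VitaliTransport: P → U → A0); LSW-type identification (support RestrictionIdentification)
then gives SLE_8/3.
Lean: `SAWAvoidanceLaw ∧ EventualTight ∧ SubseqSimple` (decls of this route file; full one-line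
terms in the items below, all elaborated in Sketch.lean)

## Assembly
Pure logic on top of AssemblyTarget (checked sorry-free in Sketch.lean:
`assembly_of_assemblyTarget`): VitaliTransport turns
(P, U) into (A0); with (T), (S) this is the Target; AssemblyTarget (Prokhorov + AvoidanceOfLimit +
RestrictionIdentification +
uniqueness of the SLE_8/3 law + subsequence principle) gives the conjunct.

Rationale: WHY THIS LINE. Kozdron–Lawler (KozdronLawler2007 §6) and Kennedy–Lawler (KennedyLawler2013 §1.1)
embed the critical SAW as the charge-zero
endpoint of an EXACT POSITIVE one-parameter family P^(s) ∝ y_c(s)^|η| exp(s·m_D(η)) whose s = 1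
member is the loop-erased
random walk (partition function = RW Green's function, Lawler2018 Prop 3.1 and 5.2) and whose filled
hulls η ∪ (soup_s-loops
touching η) are lattice restriction families for every s (Lawler's boundary-perturbation rule;
continuum: LSW03 §7.2, Thm 7.3:
SLE_κ ⊕ soup(λ_κ) = P_α, α_κ = (6−κ)/2κ, c = −2s). Instead of an observable at s = 0 we identify the
SAW avoidance law by
ANALYTIC CONTINUATION in the charge: prove the avoidance ratio R_δ(s) → d^α(s) in a perturbative
window at the free-fermion
point (P; marginal-RG precedent GiulianiMastropietroToninelli2017) and δ-uniform
holomorphy/boundedness of s ↦ R_δ(s, y(s)) on a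
complex neighbourhood of [0,1] (U; Lee–Yang/Montel input), then Vitali + the identity theorem
transport d^α(s) to s = 0
(α(0) = 5/8) with no conformal input at s = 0. Imported areas: loop measures / loop soups
(probability), normal families and
zero-free regions of partition functions (complex analysis, Lee–Yang), conformal restriction (LSW03;
the κ = 8/3 cone is PROVED in
the tree: sle_restriction_eightThirds_holds, hasSLETrace_eightThirds,
existsUnique_isRestrictionMap_holds). Unlike
SAWConfRestriction/SAWParafermion nothing conformal is ever evaluated on the SAW itself; unlike
SAWHexUniversality the homotopy
runs through a CHARGE on the same lattice; the negatives index (Tight over all δ) is avoided by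
eventual tightness.

RANKED CRUXES. #0 Target (target) — X = SAWAvoidanceLaw ∧ EventualTight ∧ SubseqSimple as in §
Thesis. (why it might fail: (A0) is LSW's conjecture quantified over ALL endpoint approximations and
all Jordan hull subdomains; an approximation-dependent or non-simple ℤ² limit kills X (and the
conjunct as typed).) [LawlerSchrammWerner2004SAW, LawlerSchrammWerner2003Restriction,
KennedyLawler2013]
#2 WindowAvoidanceLaw (crux) — (P, card crux rank 2) there are ε > 0 and fugacities y(s) > 0 with
y(1) = 1/4 such that for every s ∈ [1−ε, 1], every Dobrushin D, hull subdomain D′, endpoint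
approximation, chordal uniformizer φ and restriction data (Φ, d = Φ_A′(0)) of A = φ.pullbackHull D′:
R_δ(s) := Z(D_δ|D′; s, y(s)) / Z(D_δ; s, y(s)) → d^α(s) as δ → 0⁺, α(s) = (5+2s+√((13+2s)²−144))/16
(= (6−κ)/2κ at c(κ) = −2s; α(1) = 1, α(0) = 5/8). Here Z(D_δ|D′; s, y) = Σ_γ y^|γ| exp(s·m(γ)) over
SAWs a_δ → b_δ of D_δ using only vertices in D′ and edges inside cl D′, m(γ) = rooted random-walk
loop measure (weight 4^(−n)/n) of the loops of that sub-graph meeting γ (inlined by `let`;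
Kennedy–Lawler §1.1). At s = 1 this is the RW-excursion avoidance probability (support
AnchorExcursion). [difficulty: open-problem] (why it might fail: Marginal, not Girsanov: the tilt
e^(−(1−s)(m−Em)) fluctuates at order (1−s)δ^(−5/8) over δ^(−5/4) steps and κ must move; no
path-space perturbation theory of LERW exists; even a critical y(s) with a power-law window is only
K–L's conjecture; α(s) is the CFT value.) [KozdronLawler2007, KennedyLawler2013,
LawlerSchrammWerner2003Restriction, Lawler2018, GiulianiMastropietroToninelli2017]
#3 ChargeAnalyticity (crux) — (U, card crux rank 3) for every ε and window fugacity y_W realising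
the window law of WindowAvoidanceLaw there are an open connected N ⊆ ℂ containing [0,1] and a
holomorphic y on N with y = y_W on [1−ε,1] and y(0) = x_c = SAW.criticalFugacity such that for every
D, hull D′ and endpoint approximation there is C with: eventually in δ, s ↦ R_δ(s, y(s)) restricted
to [0,1] is the trace of a holomorphic g_δ on N with |g_δ| ≤ C (no phase transition in the charge;
zeros of Z(D_δ; s, y(s)) stay off N or cancel in the ratio). [deps: WindowAvoidanceLaw] [difficulty:
open-problem] (why it might fail: Fisher/Lee–Yang zeros of s ↦ Z(D_δ; s, y(s)) may pinch [0,1] as δ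
→ 0 (criticality on the whole segment), or y_c(s) may be non-analytic / miss x_c; only the extensive
phases cancel ((log y_c)″ = −Var(m)/n), the macroscopic ones are uncontrolled.) [KozdronLawler2007,
KennedyLawler2013, DuminilCopinKozmaYadin2014, LawlerSchrammWerner2004SAW]
#4 EventualTight (crux) — (T) for every Dobrushin domain and endpoint approximation there is δ₀ > 0
such that the critical SAW laws pushed to CurveClass ℂ, δ ∈ (0, δ₀], form a tight set (the eventual
form prescribed by the refutation of stmt-0772). [difficulty: open-problem] (why it might fail: No
annulus-crossing / Aizenman–Burchard bound for the x_c-SAW on ℤ² is in print (KS17 §4 omits SAW; no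
FKG at n = 0); sub-ballisticity (DCH13) is the strongest input; wild endpoint approximations may let
mass escape along ∂D.) [KemppainenSmirnov2017, DuminilCopinHammond2013,
Summit.CriticalPhenomena.SAWScalingLimit.Theorems.SAWParafermionTight_refuted]
#5 SubseqSimple (crux) — (S) along δ_n → 0⁺ every weak (probability) limit μ of the SAW laws in
(D_δ; a_δ, b_δ) is carried by the chordal carrier of D: simple curves from a to b inside D ∪ {a,b}
(no macroscopic self-touching, no boundary crawling). [difficulty: open-problem] (why it might fail:
Weak limits of simple polylines need not be simple: needs uniform no-near-self-touching and
no-boundary-crawling bounds for the critical SAW under every endpoint approximation; only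
sub-ballisticity is proved; LSW04 §3.4.5 argues simplicity heuristically.)
[LawlerSchrammWerner2004SAW, KennedyLawler2013, DuminilCopinHammond2013]
#9 SAWAvoidanceLaw (support) — (A0, the s = 0 endpoint; first conjunct of X; other routes may target
it directly) for every D, hull subdomain D′, endpoint approximation, chordal uniformizer and
restriction data (Φ, d) of φ.pullbackHull D′: SAW.law(D_δ; a_δ, b_δ){γ uses only vertices of D′ and
edges inside cl D′} → d^(5/8). Obtained here from P and U by VitaliTransport; it is LSW04's
restriction prediction made quantifier-precise. [difficulty: open-problem]
[LawlerSchrammWerner2004SAW, LawlerSchrammWerner2003Restriction]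
#9 VitaliTransport (support) — glue: WindowAvoidanceLaw → ChargeAnalyticity → SAWAvoidanceLaw. Fix
(D, D′, a, b, φ, Φ, d); the g_δ of U are holomorphic on N and bounded by C, converge on the real
window to d^α(s) (P), hence (Vitali–Porter / Montel + identity theorem) converge locally uniformly
on the component to the continuation of d^α(s), which at s = 0 is d^(5/8); and g_δ(0) = R_δ(0, x_c)
= the SAW probability of the event in SAWAvoidanceLaw (Z at s = 0 is the x_c^|γ|-sum). [difficulty:
M] [KozdronLawler2007, LawlerSchrammWerner2003Restriction]
#9 AnchorExcursion (support) — the s = 1, y = 1/4 case of the window: Z(D_δ|D′; 1, 1/4) is the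
Green's function of the simple random walk killed outside the D′-sub-graph (Lawler2018 Prop 3.1 with
Prop 5.2: Σ_(LE(ω)=η) 4^(−|ω|) = 4^(−|η|) e^(m(η))), so R_δ(1) = P[RW from a_δ conditioned to reach
b_δ in D_δ stays in the D′-sub-graph]·(1+o(1)) → P[Brownian excursion a → b in D avoids D ∖ D′] =
Φ_A′(0) = d (LSW03 Prop 4.1, proved in the tree for the Brownian side:
exists_isRestrictionMeasure_one_brownianQuad). [difficulty: L] [Lawler2018,
LawlerSchrammWerner2003Restriction, LawlerLimic2010, KozdronLawler2007]
#9 RestrictionIdentification (support) — LSW identification from avoidance numbers: a probability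
law μ on CurveClass ℂ carried by chordalCarrier D whose masses of {range ⊆ cl D′} equal d^(5/8) for
all hull subdomains D′ (d = Φ_A′(0), A = φ.pullbackHull D′) is the chordal SLE_8/3 law of D. Proof
sketch: pull back by φ (RestrictionPullback), extend the formula from pull-back hulls of Jordan hull
subdomains to all *-hulls (exists_antitone_isArcHull_holds, monotone continuity), get
IsRestrictionMeasure (5/8), apply IsRestrictionMeasure.eq_map_sleTrace_eightThirds
(hasSLETrace_eightThirds, sle_restriction_eightThirds_holds) and return to D as in
RestrictionUniqueness (ext_of_missCode_injOn). [difficulty: L] [LawlerSchrammWerner2003Restriction,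
RohdeSchramm2005]
#9 AvoidanceOfLimit (support) — glue: SAWAvoidanceLaw ⇒ every subsequential weak limit μ of the SAW
laws in D gives mass d^(5/8) to {range ⊆ cl D′} for every hull subdomain D′ with restriction data
(φ, Φ, d). Sandwich by portmanteau: the lattice event for D′ forces the polyline into cl D′ (closed
event, limsup), and {range ⊆ U}, U = ℂ ∖ cl(D ∖ D‴) open, forces the lattice event for an inner hull
subdomain D‴; continuity of Φ_A′(0) under inner exhaustion of A closes the gap. No simplicity
needed. [difficulty: M] [LawlerSchrammWerner2004SAW, LawlerSchrammWerner2003Restriction]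
#9 AssemblyTarget (support) — RestrictionIdentification → AvoidanceOfLimit → Target →
SAWScalingLimit: laws are eventually probability measures (IsEndpointApprox.reachable; DomainSAW
finite); EventualTight + Prokhorov (CurveClass ℂ Polish, polishSpace_holds) give subsequential
limits along any δ_n → 0⁺; SubseqSimple puts them on chordalCarrier D; AvoidanceOfLimit +
RestrictionIdentification make each the SLE_8/3 law, unique (IsSLECurve.map_eq via
identDistrib_sleTrace_scale_holds) and realised (exists_isSLECurve_of_ne_eight); the subsequence
principle along the first-countable filter 𝓝[>]0 yields ConvergesInLawToSLE (8/3). [difficulty: M]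
[LawlerSchrammWerner2004SAW, KemppainenSmirnov2017]

TWO-LAYER PLAN. Foreseen glued splits (none filed now): WindowAvoidanceLaw ⇐
CovarianceRepresentation (d/ds log R_δ = Cov_s(1, m + |γ|(log y)′),
the lambda-flow carry-over) → UniformWindowLimit → WindowAvoidanceLaw; ChargeAnalyticity ⇐
BulkPressureAnalytic (half-plane
pressure π(s) = −log y_c(s) analytic, n-step tilted sums zero-free in a strip) →
RatioBoundedGivenBulk → ChargeAnalyticity;
EventualTight ⇐ annulus-crossing bound (KS Condition G2, shared with SAWParafermion r5) →
EventualTight; SubseqSimple ⇐ Brownian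
domination of hull hitting (card brownian-domination-simple-limits) → SubseqSimple.

KILL CRITERIA. ¬ChargeAnalyticity (zeros of s ↦ Z(D_δ; s, y(s)) marching onto [0,1], or y_c provably
non-analytic) kills the Vitali mechanism:
pivot once to the weaker split "lim_δ R_δ(s) exists for all real s ∈ [0,1] and is real-analytic" or
close `refuted:ChargeAnalyticity`.
¬WindowAvoidanceLaw at s = 1 (¬AnchorExcursion) means the discretisation is mis-specified → restate,
not close; ¬WindowAvoidanceLaw
for s < 1 with the CFT α(s) but some other analytic α̃ → restate P with ∃ α̃ (the scheme survives;
simplicity then forces α̃(0) = 5/8);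
no window at all → close. ¬EventualTight, ¬SubseqSimple or ¬SAWAvoidanceLaw (approximation-dependent
limit) refute the conjunct as
typed for every route. ConfCovLimit (SAWConfRestriction r2) proved elsewhere moots P and U
(supersede).

NOT DECOMPOSED YET. The LERW identity Σ_(LE(ω)=η) q^|ω| = q^|η| e^(m(η)) and det/Green's-function
forms of e^m (lattice lemmas under AnchorExcursion);
discrete potential theory for the excursion (Poisson-kernel ratios in rough Jordan domains, boundary
Harnack uniform in δ);
Vitali–Porter/Montel in Lean; Prokhorov bookkeeping; inner/outer hull approximation and continuity
of Φ_A′(0); a canonical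
definition of y_c(s) (half-plane pressure) — deliberately existential in P/U; the filled-hull
restriction family K^(s) and the
SLE_κ(s) identification for 0 < s < 1 (not needed for the conjunct); radial/bulk variants.

CHEAPEST FALSIFIER. (i) kit, minutes: enumerate SAWs a → b in n × n boxes (n ≤ 7) with a sub-box D′,
compute e^(m(γ)) = det(I−P_(V∖γ))/det(I−P_V)
exactly, and track the complex-s zeros of s ↦ Z(D_n; s, y_n(s)) nearest to [0,1] (y_n(s) log-convex
interpolation pinned by
y(1) = 1/4, y(0) = 1/2.638 and by maximising the box 'susceptibility') as n grows: zeros approaching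
(0,1) at rate n^(−θ) kill U.
(ii) exact sampling of P^(s) at s = 1/2 for small systems (LERW ⊕ independent soup(1−s) rejection,
reweight (4y)^|η|): compare
avoidance ratios with d^α(1/2), α(1/2) = (6+√52)/16 ≈ 0.826 (κ ≈ 2.263); a mismatch kills the
explicit α(s) (restate with ∃ α̃).
(iii) lookup done here: the s = 1 anchor is consistent with LSW03 Prop 4.1 (proved in the tree for
the Brownian excursion) and no
non-analyticity result for loop-measure-tilted SAW generating functions was found (zbMATH/Crossref
searches listed under Novelty).
Not run myself: the hub is compute-free and the enumeration code is not yet written (kit job for the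
first refuter).

NUMBERS. c(κ) = (3κ−8)(6−κ)/(2κ); c = −2s; κ(s) = (13+2s−√((13+2s)²−144))/3: κ(1) = 2, κ(1/2) ≈
2.263, κ(0) = 8/3, branch point s = −1/2
(κ = 4). α(s) = (6−κ)/(2κ) = (5+2s+√((13+2s)²−144))/16: α(1) = 1, α(3/4) ≈ 0.915, α(1/2) ≈ 0.826,
α(1/4) ≈ 0.730, α(0) = 5/8.
LSW03 §7.2: λ_κ = (8−3κ)(6−κ)/(2κ) (λ_2 = 2 = 2s at s = 1). y(1) = 1/4 exactly; x_c = 1/μ(ℤ²) ∈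
[1/2.7, 1/2.6]
(LawlerSchrammWerner2004SAW_connectiveConstant_bounds), μ ≈ 2.63816 numerically. Items at open: 12
(4 cruxes).

DEFINITION REQUESTS. After open: (1) notion `rwLoopMass` (topic
Literature/Probability/RandomPlanarGeometry): rooted random-walk loop measure mass
Σ 4^(−|ℓ|)/|ℓ| of the closed walks of a sub-graph of δℤ² meeting a finite vertex set
(KennedyLawler2013 §1.1; Lawler2018 Def. 10,
Prop 5.2) — would replace the `let m` of P/U/AnchorExcursion and serve cards
loop-avoidance-chaos-sle2, determinantal-square-c0-diagonal;
(2) notion `tiltedSAWPartitionFunction` (λ-SAW weights y^|γ| e^(s·m) on SAW.DomainSAW restricted to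
a sub-domain; KozdronLawler2007 §6).
No cite facts needed: the κ = 8/3 restriction cone is proved in the tree.

Novelty: Searches (2026-08-15): `lit search --hybrid "lambda-SAW loop measure self-avoiding excursion
loop-erased Kozdron Lawler"` (8 local docs:
Lawler2005 book, Lawler1991, Lyons–Peres; nothing on continuation); `lit vsearch "<the λ-SAW family
in prose>"` (10 docs: Lawler2005,
Slade2006, Madras–Slade, Friedli–Velenik); zbMATH "configurational measure mutually avoiding SLE"
(3: KozdronLawler2007, Kozdron 2009);
Crossref/zbMATH "self-avoiding walk loop measure loop-erased SLE", "… analytic continuation loop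
soup", "Fomin identity …" (5–7 rows each:
Lawler 1983/86/87/88 loop-erased SAW, Majumdar 1992, HattoriOgoOtsuka2017, LawlerLimic2010 ch. 11,
Beneš–Lawler–Viklund 2016);
`lit galaxy search --star all` ×3 ("lambda-SAW", "self-avoiding excursion", long phrase: 0 substring
rows; pdf/crabby stars timed out);
`lit frontier CriticalPhenomena --since 2020` (30 rows, none on λ-SAW); `lit bridges
CriticalPhenomena --cross any` (30 rows, none);
arXiv/OpenAlex rate-limited today. Reads: KozdronLawler2007 pp.13,16 (§4 loop soup ⊕ LERW =
excursion; §6 λ-SAW, r_λ, conjecture),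
KennedyLawler2013 pp.4–5 (§1.1: m_D, β_c(c), κ(c), b), Lawler2018 Prop 3.1/5.1/5.2, LSW03 §7.2 (α_κ,
λ_κ, Thm 7.3) and §9 (loop soup).
Nearest prior art found: KozdronLawler2007 §6 with KennedyLawler2013 §1.1 — the family, its
criticality conjecture and the SLE_κ(c)
prediction (static; 'λ = 0 is equivalent to very difficult conjectures about SAW');
HattoriOgoOtsuka2017 — an LERW–SAW interpolating
family with RG-controlled c  [refs: Lawler2005, Lawler1991, KozdronLawler2007, HattoriOgoOtsuka2017, LawlerLimic2010, KennedyLawler2013, Lawler2018, GiulianiMastropietroToninelli2017]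

Barriers (technique_class: charge-continuation loop-soup-tilt vitali restriction): - technique_class: charge-continuation loop-soup-tilt vitali restriction
- Literature.Barriers.CriticalPhenomena.SupercriticalSAWSpaceFilling: applies with full force and is
respected — nothing is open in the fugacity: U pins y(0) = x_c exactly and makes analyticity of the
critical curve y(s) part of the claim; off the curve R_δ degenerates (DKY Thm 1 / subcritical
geodesics), which is exactly why Vitali needs y(s) and not a neighbourhood of it.
- Literature.Barriers.CriticalPhenomena.NienhuisWeightsExcludeVertexSAW: not applicable — no
discrete observable and no exact vertex relation at any s; the only exactly solvable input is the
random walk at s = 1.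
- Literature.Barriers.CriticalPhenomena.ParafermionicHalfCauchyRiemann: not applicable for the same
reason (no discrete holomorphicity is claimed or needed).
- Literature.Barriers.CriticalPhenomena.GridSAWCountingSharpPComplete: evaded — determinants / loop
masses enter only as weights e^(s·m(γ)) inside the sum over SAWs; at s = 0 it is the plain SAW sum;
no closed form or polynomial-time count on sub-domains is asserted.
- Literature.Barriers.CriticalPhenomena.SAWNotKineticallyGrown: not applicable — the λ-SAW is
configurational (Gibbsian) for every s; the growth (Laplacian) description enters only at s = 1
inside AnchorExcursion, where it coincides with the configurational one.
- Literature.Barriers.CriticalPhenomena.SAWNoUnitaryCFT: not applicable — c(s) = −2s ≤ 0 is used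
only as the heuristic source of the explicit expone

History (route lifecycle, newest last):
- 2026-08-15T16:53:24Z · rev 2: restated Target (stmt-CriticalPhenomena-4919), WindowAvoidanceLaw (stmt-CriticalPhenomena-4920), ChargeAnalyticity (stmt-CriticalPhenomena-4921), SubseqSimple (stmt-CriticalPhenomena-4923), SAWAvoidanceLaw (stmt-CriticalPhenomena-4924), AnchorExcursion (stmt-CriticalPhenomena-4926), RestrictionIdentification (st (planner-rbadge-CriticalPhenomena-SAWChargeCont-7dfceb3b-g4-0)
- 2026-08-22T07:36:46Z · DORMANT — reconciler: no traction for 5.2 d (last activity item-evidence-added at 2026-08-17T02:52:06Z); parked, not closed — `ledger route dormant route-CriticalPhenomen (operator:999:2430076)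

sub-problem: SAWScalingLimit · status: dormant · opened planner-plancard-CriticalPhenomena-SAWScaling-99608a72-0 2026-08-15T11:35:43Z · rev 3 · ledger route-CriticalPhenomena-SAWChargeContinuation
GENERATED by the gate from the ledger (D-0016/17). Provers cite these decls: `theorem foo : Summit.CriticalPhenomena.SAWScalingLimit.Theses.SAWChargeContinuation.<Decl> := …` in Summits/CriticalPhenomena/SAWScalingLimit/Theorems/<Name>.lean.
-/

namespace Summit.CriticalPhenomena.SAWScalingLimit.Theses.SAWChargeContinuation

open scoped BigOperators Topology Manifold Classical MeasureTheory ProbabilityTheory Matrix InnerProductSpace ComplexConjugate ContinuousMap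
open Filter Set Function TopologicalSpace MeasureTheory

attribute [summit_statement] _root_.SAWScalingLimit

-- earlier Target (stmt-CriticalPhenomena-4919, replaced 2026-08-15T16:53:24Z -> stmt-CriticalPhenomena-11191): retired by None — (∀ (D D' : Literature.Probability.RandomPlanarGeometry.DobrushinDomain), D.IsHullSubdomain D' → ∀ (a b : ℝ → Literature.Probability.LatticeModels.Site 2), Literature.Probability.RandomPlanarGeometry.SAW.IsEndpointApprox D a b → ∀ (φ : Literature.Probability.RandomPlanarGeo
/-- item stmt-CriticalPhenomena-11191 · target · rank 0 · open · by planner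
why it might fail: (A0) is LSW's conjecture quantified over ALL endpoint approximations and all Jordan hull subdomains; an approximation-dependent or non-simple ℤ² limit kills X (and the conjunct as typed).
sources: LawlerSchrammWerner2004SAW, LawlerSchrammWerner2003Restriction, KennedyLawler2013
[target] X = SAWAvoidanceLaw ∧ EventualTight ∧ SubseqSimple as in § Thesis. [reroute 2026-08-15:
`MarkedDomain.IsHullSubdomain` and `ConformalEquiv.pullbackHull` are inlined as the lets `hull` /
`pb` (definitionally equal, Iff.rfl with the rev-1 text) so that the route imports only
`RestrictionHulls` above the Statement cone; provers may `show` the folded form after importing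
HullSubdomainPullback in their Theorems file.] [reroute 2026-08-15: `chordalCarrier D` is inlined as
the let `carrier` (= CurveClass.simple ∩ source/target = a,b ∩ range ⊆ D ∪ {a,b}; definitionally
`chordalCarrier`, HullRestrictionTests) so that the route imports stay inside the Statement cone +
RestrictionHulls.] -/
@[route_item "route-CriticalPhenomena-SAWChargeContinuation"]
def Target : Prop :=
  (let hull : Literature.Probability.RandomPlanarGeometry.DobrushinDomain → Literature.Probability.RandomPlanarGeometry.DobrushinDomain → Prop := fun D D' => D'.carrier ⊆ D.carrier ∧ D'.pt 0 = D.pt 0 ∧ D'.pt 1 = D.pt 1 ∧ D.pt 0 ∉ closure (D.carrier \ D'.carrier) ∧ D.pt 1 ∉ closure (D.carrier \ D'.carrier); let pb : (D : Literature.Probability.RandomPlanarGeometry.DobrushinDomain) → Literature.Probability.RandomPlanarGeometry.ConformalEquiv UpperHalfPlane.upperHalfPlaneSet D.carrier → Literature.Probability.RandomPlanarGeometry.DobrushinDomain → Set ℂ := fun _ φ D' => closure (UpperHalfPlane.upperHalfPlaneSet \ {z | z ∈ UpperHalfPlane.upperHalfPlaneSet ∧ φ z ∈ D'.carrier}); ∀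 (D D' : Literature.Probability.RandomPlanarGeometry.DobrushinDomain), hull D D' → ∀ (a b : ℝ → Literature.Probability.LatticeModels.Site 2), Literature.Probability.RandomPlanarGeometry.SAW.IsEndpointApprox D a b → ∀ (φ : Literature.Probability.RandomPlanarGeometry.ConformalEquiv UpperHalfPlane.upperHalfPlaneSet D.carrier), D.IsChordalUniformizing φ → ∀ (Φ : Literature.Probability.RandomPlanarGeometry.ConformalEquiv (UpperHalfPlane.upperHalfPlaneSet \ pb D φ D') UpperHalfPlane.upperHalfPlaneSet) (d : ℝ), Literature.Probability.RandomPlanarGeometry.IsRestrictionMap (pb D φ D') Φ → Literature.Probability.RandomPlanarGeometry.HasRestrictionDeriv (pb D φ D') Φ d → Filter.Tendsto (fun δ => (Literature.Probability.RandomPlanarGeometry.SAW.law D.carrier δ (a δ) (b δ) {γ | ∀ e ∈ γ.walk.darts, (Literature.Probability.LatticeModels.meshGraph D'.carrier δ).Adj e.fst e.snd ∧ e.fst ∈ Literature.Probability.LatticeModels.meshVertices D'.carrier δ ∧ e.snd ∈ Literature.Probability.LatticeModels.meshVertices D'.carrier δ}).toReal) (nhdsWithin 0 (Set.Ioi 0))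 (nhds (d ^ (5 / 8 : ℝ)))) ∧ (∀ (D : Literature.Probability.RandomPlanarGeometry.DobrushinDomain) (a b : ℝ → Literature.Probability.LatticeModels.Site 2), Literature.Probability.RandomPlanarGeometry.SAW.IsEndpointApprox D a b → ∃ δ₀ > (0 : ℝ), MeasureTheory.IsTightMeasureSet ((fun δ => (Literature.Probability.RandomPlanarGeometry.SAW.law D.carrier δ (a δ) (b δ)).map (fun γ => γ.curve)) '' Set.Ioc 0 δ₀)) ∧ (let carrier : Literature.Probability.RandomPlanarGeometry.DobrushinDomain → Set (Literature.Probability.RandomPlanarGeometry.CurveClass ℂ) := fun D => Literature.Probability.RandomPlanarGeometry.CurveClass.simple ∩ {c | c.source = D.pt 0} ∩ {c | c.target = D.pt 1} ∩ {c | c.range ⊆ D.carrier ∪ {D.pt 0, D.pt 1}}; ∀ (D : Literature.Probability.RandomPlanarGeometry.DobrushinDomain) (a b : ℝ → Literature.Probability.LatticeModels.Site 2), Literature.Probability.RandomPlanarGeometry.SAW.IsEndpointApprox D a b → ∀ (s : ℕ → ℝ) (μ : MeasureTheory.Measure (Literature.Probability.RandomPlanarGeometry.CurveClass ℂ)), Filter.Tendsto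 s Filter.atTop (nhdsWithin 0 (Set.Ioi 0)) → MeasureTheory.IsProbabilityMeasure μ → (∀ f : BoundedContinuousFunction (Literature.Probability.RandomPlanarGeometry.CurveClass ℂ) ℝ, Filter.Tendsto (fun n => ∫ γ, f γ.curve ∂(Literature.Probability.RandomPlanarGeometry.SAW.law D.carrier (s n) (a (s n)) (b (s n)))) Filter.atTop (nhds (∫ x, f x ∂μ))) → ∀ᵐ γ ∂μ, γ ∈ carrier D)

-- earlier WindowAvoidanceLaw (stmt-CriticalPhenomena-4920, replaced 2026-08-15T16:53:24Z -> stmt-CriticalPhenomena-11192): retired by None — let G : Set ℂ → Set ℂ → ℝ → SimpleGraph (Literature.Probability.LatticeModels.Site 2) := fun Ω Ω' δ => SimpleGraph.fromRel fun x y => (Literature.Probability.LatticeModels.discreteDomainGraph Ω δ).Adj x y ∧ (Literature.Probability.LatticeModels.meshGraph Ω' δ).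
/-- item stmt-CriticalPhenomena-11192 · crux · rank 2 · open · by planner
why it might fail: Marginal, not Girsanov: the tilt e^(−(1−s)(m−Em)) fluctuates at order (1−s)δ^(−5/8) over δ^(−5/4) steps and κ must move; no path-space perturbation theory of LERW exists; even a critical y(s) with a power-law window is only K–L's conjecture; α(s) is the CFT value.
sources: KozdronLawler2007, KennedyLawler2013, LawlerSchrammWerner2003Restriction, Lawler2018, GiulianiMastropietroToninelli2017
[crux] (P, card crux rank 2) there are ε > 0 and fugacities y(s) > 0 with y(1) = 1/4 such that for
every s ∈ [1−ε, 1], every Dobrushin D, hull subdomain D′, endpoint approximation, chordal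
uniformizer φ and restriction data (Φ, d = Φ_A′(0)) of A = φ.pullbackHull D′: R_δ(s) := Z(D_δ|D′; s,
y(s)) / Z(D_δ; s, y(s)) → d^α(s) as δ → 0⁺, α(s) = (5+2s+√((13+2s)²−144))/16 (= (6−κ)/2κ at c(κ) =
−2s; α(1) = 1, α(0) = 5/8). Here Z(D_δ|D′; s, y) = Σ_γ y^|γ| exp(s·m(γ)) over SAWs a_δ → b_δ of D_δ
using only vertices in D′ and edges inside cl D′, m(γ) = rooted random-walk loop measure (weight
4^(−n)/n) of the loops of that sub-graph meeting γ (inlined by `let`; Kennedy–Lawler §1.1). At s = 1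
this is the RW-excursion avoidance probability (support AnchorExcursion). [difficulty: open-problem]
[reroute 2026-08-15: `MarkedDomain.IsHullSubdomain` and `ConformalEquiv.pullbackHull` are inlined as
the lets `hull` / `pb` (definitionally equal, Iff.rfl with the rev-1 text) so that the route imports
only `RestrictionHulls` above the Statement cone; provers may `show` the folded form after importing
HullSubdomainPullback in their Theorems file.] -/
@[route_item "route-CriticalPhenomena-SAWChargeContinuation", crux]
def WindowAvoidanceLaw : Prop :=
  let hull : Literature.Probability.RandomPlanarGeometry.DobrushinDomain → Literature.Probability.RandomPlanarGeometry.DobrushinDomain → Prop := fun D D' => D'.carrier ⊆ D.carrier ∧ D'.pt 0 = D.pt 0 ∧ D'.pt 1 = D.pt 1 ∧ D.pt 0 ∉ closure (D.carrier \ D'.carrier) ∧ D.pt 1 ∉ closure (D.carrier \ D'.carrier); let pb : (D : Literature.Probability.RandomPlanarGeometry.DobrushinDomain) → Literature.Probability.RandomPlanarGeometry.ConformalEquiv UpperHalfPlane.upperHalfPlaneSet D.carrier → Literature.Probability.RandomPlanarGeometry.DobrushinDomain → Set ℂ := fun _ φ D' => closure (UpperHalfPlane.upperHalfPlaneSet \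 {z | z ∈ UpperHalfPlane.upperHalfPlaneSet ∧ φ z ∈ D'.carrier}); let G : Set ℂ → Set ℂ → ℝ → SimpleGraph (Literature.Probability.LatticeModels.Site 2) := fun Ω Ω' δ => SimpleGraph.fromRel fun x y => (Literature.Probability.LatticeModels.discreteDomainGraph Ω δ).Adj x y ∧ (Literature.Probability.LatticeModels.meshGraph Ω' δ).Adj x y ∧ x ∈ Literature.Probability.LatticeModels.meshVertices Ω' δ ∧ y ∈ Literature.Probability.LatticeModels.meshVertices Ω' δ; let m : (Ω Ω' : Set ℂ) → (δ : ℝ) → (a b : Literature.Probability.LatticeModels.Site 2) → Literature.Probability.RandomPlanarGeometry.SAW.DomainSAW Ω δ a b → ℝ := fun Ω Ω' δ _ _ γ => ∑' p : (Σ x : Literature.Probability.LatticeModels.Site 2, (G Ω Ω' δ).Walk x x), if 0 < p.2.length ∧ (∃ v ∈ p.2.support, v ∈ γ.walk.support) then (1 / 4 : ℝ) ^ p.2.length / (p.2.length : ℝ) else 0; let Z : (Ω Ω' : Set ℂ) → (δ : ℝ) → (a b : Literature.Probability.LatticeModels.Site 2) → ℂ → ℂ → ℂ := fun Ω Ω'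 δ a b s y => ∑' γ : Literature.Probability.RandomPlanarGeometry.SAW.DomainSAW Ω δ a b, if (∀ e ∈ γ.walk.darts, (G Ω Ω' δ).Adj e.fst e.snd) then y ^ γ.length * Complex.exp (s * (m Ω Ω' δ a b γ : ℂ)) else 0; let α : ℝ → ℝ := fun s => (5 + 2 * s + Real.sqrt ((13 + 2 * s) ^ 2 - 144)) / 16; ∃ ε > (0 : ℝ), ∃ y : ℝ → ℝ, y 1 = 1 / 4 ∧ ∀ s ∈ Set.Icc (1 - ε) 1, 0 < y s ∧ ∀ (D D' : Literature.Probability.RandomPlanarGeometry.DobrushinDomain), hull D D' → ∀ (a b : ℝ → Literature.Probability.LatticeModels.Site 2), Literature.Probability.RandomPlanarGeometry.SAW.IsEndpointApprox D a b → ∀ (φ : Literature.Probability.RandomPlanarGeometry.ConformalEquiv UpperHalfPlane.upperHalfPlaneSet D.carrier), D.IsChordalUniformizing φ → ∀ (Φ : Literature.Probability.RandomPlanarGeometry.ConformalEquiv (UpperHalfPlane.upperHalfPlaneSet \ pb D φ D') UpperHalfPlane.upperHalfPlaneSet) (d : ℝ), Literature.Probability.RandomPlanarGeometry.IsRestrictionMap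 (pb D φ D') Φ → Literature.Probability.RandomPlanarGeometry.HasRestrictionDeriv (pb D φ D') Φ d → Filter.Tendsto (fun δ => Z D.carrier D'.carrier δ (a δ) (b δ) s (y s) / Z D.carrier D.carrier δ (a δ) (b δ) s (y s)) (nhdsWithin 0 (Set.Ioi 0)) (nhds ((d ^ (α s) : ℝ) : ℂ))

-- earlier ChargeAnalyticity (stmt-CriticalPhenomena-4921, replaced 2026-08-15T16:53:24Z -> stmt-CriticalPhenomena-11193): retired by None — let G : Set ℂ → Set ℂ → ℝ → SimpleGraph (Literature.Probability.LatticeModels.Site 2) := fun Ω Ω' δ => SimpleGraph.fromRel fun x y => (Literature.Probability.LatticeModels.discreteDomainGraph Ω δ).Adj x y ∧ (Literature.Probability.LatticeModels.meshGraph Ω' δ).A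
/-- item stmt-CriticalPhenomena-11193 · crux · rank 3 · open · by planner
why it might fail: Fisher/Lee–Yang zeros of s ↦ Z(D_δ; s, y(s)) may pinch [0,1] as δ → 0 (criticality on the whole segment), or y_c(s) may be non-analytic / miss x_c; only the extensive phases cancel ((log y_c)″ = −Var(m)/n), the macroscopic ones are uncontrolled.
sources: KozdronLawler2007, KennedyLawler2013, DuminilCopinKozmaYadin2014, LawlerSchrammWerner2004SAW
[crux] (U, card crux rank 3) for every ε and window fugacity y_W realising the window law of
WindowAvoidanceLaw there are an open connected N ⊆ ℂ containing [0,1] and a holomorphic y on N with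
y = y_W on [1−ε,1] and y(0) = x_c = SAW.criticalFugacity such that for every D, hull D′ and endpoint
approximation there is C with: eventually in δ, s ↦ R_δ(s, y(s)) restricted to [0,1] is the trace of
a holomorphic g_δ on N with |g_δ| ≤ C (no phase transition in the charge; zeros of Z(D_δ; s, y(s))
stay off N or cancel in the ratio). [deps: WindowAvoidanceLaw] [difficulty: open-problem] [reroute
2026-08-15: `MarkedDomain.IsHullSubdomain` and `ConformalEquiv.pullbackHull` are inlined as the lets
`hull` / `pb` (definitionally equal, Iff.rfl with the rev-1 text) so that the route imports only
`RestrictionHulls` above the Statement cone; provers may `show` the folded form after importing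
HullSubdomainPullback in their Theorems file.] -/
@[route_item "route-CriticalPhenomena-SAWChargeContinuation", crux]
def ChargeAnalyticity : Prop :=
  let hull : Literature.Probability.RandomPlanarGeometry.DobrushinDomain → Literature.Probability.RandomPlanarGeometry.DobrushinDomain → Prop := fun D D' => D'.carrier ⊆ D.carrier ∧ D'.pt 0 = D.pt 0 ∧ D'.pt 1 = D.pt 1 ∧ D.pt 0 ∉ closure (D.carrier \ D'.carrier) ∧ D.pt 1 ∉ closure (D.carrier \ D'.carrier); let pb : (D : Literature.Probability.RandomPlanarGeometry.DobrushinDomain) → Literature.Probability.RandomPlanarGeometry.ConformalEquiv UpperHalfPlane.upperHalfPlaneSet D.carrier → Literature.Probability.RandomPlanarGeometry.DobrushinDomain → Set ℂ := fun _ φ D' => closure (UpperHalfPlane.upperHalfPlaneSet \ {z | z ∈ UpperHalfPlane.upperHalfPlaneSet ∧ φ z ∈ D'.carrier}); let G : Set ℂ → Set ℂ → ℝ → SimpleGraph (Literature.Probability.LatticeModels.Site 2) := fun Ω Ω' δ => SimpleGraph.fromRel fun x y => (Literature.Probability.LatticeModels.discreteDomainGraph Ω δ).Adj x y ∧ (Literature.Probability.LatticeModels.meshGraph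 Ω' δ).Adj x y ∧ x ∈ Literature.Probability.LatticeModels.meshVertices Ω' δ ∧ y ∈ Literature.Probability.LatticeModels.meshVertices Ω' δ; let m : (Ω Ω' : Set ℂ) → (δ : ℝ) → (a b : Literature.Probability.LatticeModels.Site 2) → Literature.Probability.RandomPlanarGeometry.SAW.DomainSAW Ω δ a b → ℝ := fun Ω Ω' δ _ _ γ => ∑' p : (Σ x : Literature.Probability.LatticeModels.Site 2, (G Ω Ω' δ).Walk x x), if 0 < p.2.length ∧ (∃ v ∈ p.2.support, v ∈ γ.walk.support) then (1 / 4 : ℝ) ^ p.2.length / (p.2.length : ℝ) else 0; let Z : (Ω Ω' : Set ℂ) → (δ : ℝ) → (a b : Literature.Probability.LatticeModels.Site 2) → ℂ → ℂ → ℂ := fun Ω Ω' δ a b s y => ∑' γ : Literature.Probability.RandomPlanarGeometry.SAW.DomainSAW Ω δ a b, if (∀ e ∈ γ.walk.darts, (G Ω Ω' δ).Adj e.fst e.snd) then y ^ γ.length * Complex.exp (s * (m Ω Ω' δ a b γ : ℂ)) else 0; let α : ℝ → ℝ := fun s => (5 + 2 * s + Real.sqrt ((13 + 2 * s) ^ 2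 - 144)) / 16; ∀ (ε : ℝ) (yW : ℝ → ℝ), 0 < ε → (yW 1 = 1 / 4 ∧ ∀ s ∈ Set.Icc (1 - ε) 1, 0 < yW s ∧ ∀ (D D' : Literature.Probability.RandomPlanarGeometry.DobrushinDomain), hull D D' → ∀ (a b : ℝ → Literature.Probability.LatticeModels.Site 2), Literature.Probability.RandomPlanarGeometry.SAW.IsEndpointApprox D a b → ∀ (φ : Literature.Probability.RandomPlanarGeometry.ConformalEquiv UpperHalfPlane.upperHalfPlaneSet D.carrier), D.IsChordalUniformizing φ → ∀ (Φ : Literature.Probability.RandomPlanarGeometry.ConformalEquiv (UpperHalfPlane.upperHalfPlaneSet \ pb D φ D') UpperHalfPlane.upperHalfPlaneSet) (d : ℝ), Literature.Probability.RandomPlanarGeometry.IsRestrictionMap (pb D φ D') Φ → Literature.Probability.RandomPlanarGeometry.HasRestrictionDeriv (pb D φ D') Φ d → Filter.Tendsto (fun δ => Z D.carrier D'.carrier δ (a δ) (b δ) s (yW s) / Z D.carrier D.carrier δ (a δ) (b δ) s (yW s)) (nhdsWithin 0 (Set.Ioi 0)) (nhds ((d ^ (α s) : ℝ) : ℂ)))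 → ∃ N : Set ℂ, IsOpen N ∧ IsConnected N ∧ (∀ t ∈ Set.Icc (0 : ℝ) 1, (t : ℂ) ∈ N) ∧ ∃ y : ℂ → ℂ, DifferentiableOn ℂ y N ∧ (∀ t ∈ Set.Icc (1 - ε) 1, y t = yW t) ∧ y 0 = (Literature.Probability.RandomPlanarGeometry.SAW.criticalFugacity : ℂ) ∧ ∀ (D D' : Literature.Probability.RandomPlanarGeometry.DobrushinDomain), hull D D' → ∀ (a b : ℝ → Literature.Probability.LatticeModels.Site 2), Literature.Probability.RandomPlanarGeometry.SAW.IsEndpointApprox D a b → ∃ C : ℝ, ∀ᶠ δ in nhdsWithin 0 (Set.Ioi 0), ∃ g : ℂ → ℂ, DifferentiableOn ℂ g N ∧ (∀ s ∈ N, ‖g s‖ ≤ C) ∧ ∀ t ∈ Set.Icc (0 : ℝ) 1, g t = Z D.carrier D'.carrier δ (a δ) (b δ) t (y t) / Z D.carrier D.carrier δ (a δ) (b δ) t (y t)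

/-- item stmt-CriticalPhenomena-4922 · crux · rank 4 · open · by planner
why it might fail: No annulus-crossing / Aizenman–Burchard bound for the x_c-SAW on ℤ² is in print (KS17 §4 omits SAW; no FKG at n = 0); sub-ballisticity (DCH13) is the strongest input; wild endpoint approximations may let mass escape along ∂D.
sources: KemppainenSmirnov2017, DuminilCopinHammond2013, Summit.CriticalPhenomena.SAWScalingLimit.Theorems.SAWParafermionTight_refuted
[crux] (T) for every Dobrushin domain and endpoint approximation there is δ₀ > 0 such that the
critical SAW laws pushed to CurveClass ℂ, δ ∈ (0, δ₀], form a tight set (the eventual form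
prescribed by the refutation of stmt-0772). [difficulty: open-problem] -/
@[route_item "route-CriticalPhenomena-SAWChargeContinuation", crux]
def EventualTight : Prop :=
  ∀ (D : Literature.Probability.RandomPlanarGeometry.DobrushinDomain) (a b : ℝ → Literature.Probability.LatticeModels.Site 2), Literature.Probability.RandomPlanarGeometry.SAW.IsEndpointApprox D a b → ∃ δ₀ > (0 : ℝ), MeasureTheory.IsTightMeasureSet ((fun δ => (Literature.Probability.RandomPlanarGeometry.SAW.law D.carrier δ (a δ) (b δ)).map (fun γ => γ.curve)) '' Set.Ioc 0 δ₀)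

-- earlier SubseqSimple (stmt-CriticalPhenomena-4923, replaced 2026-08-15T16:53:24Z -> stmt-CriticalPhenomena-11194): retired by None — ∀ (D : Literature.Probability.RandomPlanarGeometry.DobrushinDomain) (a b : ℝ → Literature.Probability.LatticeModels.Site 2), Literature.Probability.RandomPlanarGeometry.SAW.IsEndpointApprox D a b → ∀ (s : ℕ → ℝ) (μ : MeasureTheory.Measure (Literature.Probability.Rand
/-- item stmt-CriticalPhenomena-11194 · crux · rank 5 · open · by planner
why it might fail: Weak limits of simple polylines need not be simple: needs uniform no-near-self-touching and no-boundary-crawling bounds for the critical SAW under every endpoint approximation; only sub-ballisticity is proved; LSW04 §3.4.5 argues simplicity heuristically.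
sources: LawlerSchrammWerner2004SAW, KennedyLawler2013, DuminilCopinHammond2013
[crux] (S) along δ_n → 0⁺ every weak (probability) limit μ of the SAW laws in (D_δ; a_δ, b_δ) is
carried by the chordal carrier of D: simple curves from a to b inside D ∪ {a,b} (no macroscopic
self-touching, no boundary crawling). [difficulty: open-problem] [reroute 2026-08-15:
`chordalCarrier D` is inlined as the let `carrier` (= CurveClass.simple ∩ source/target = a,b ∩
range ⊆ D ∪ {a,b}; definitionally `chordalCarrier`, HullRestrictionTests) so that the route imports
stay inside the Statement cone + RestrictionHulls.] -/
@[route_item "route-CriticalPhenomena-SAWChargeContinuation", crux]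
def SubseqSimple : Prop :=
  let carrier : Literature.Probability.RandomPlanarGeometry.DobrushinDomain → Set (Literature.Probability.RandomPlanarGeometry.CurveClass ℂ) := fun D => Literature.Probability.RandomPlanarGeometry.CurveClass.simple ∩ {c | c.source = D.pt 0} ∩ {c | c.target = D.pt 1} ∩ {c | c.range ⊆ D.carrier ∪ {D.pt 0, D.pt 1}}; ∀ (D : Literature.Probability.RandomPlanarGeometry.DobrushinDomain) (a b : ℝ → Literature.Probability.LatticeModels.Site 2), Literature.Probability.RandomPlanarGeometry.SAW.IsEndpointApprox D a b → ∀ (s : ℕ → ℝ) (μ : MeasureTheory.Measure (Literature.Probability.RandomPlanarGeometry.CurveClass ℂ)), Filter.Tendsto s Filter.atTop (nhdsWithin 0 (Set.Ioi 0)) → MeasureTheory.IsProbabilityMeasure μ → (∀ f : BoundedContinuousFunction (Literature.Probability.RandomPlanarGeometry.CurveClass ℂ) ℝ, Filter.Tendsto (fun n => ∫ γ, f γ.curve ∂(Literature.Probability.RandomPlanarGeometry.SAW.law D.carrier (s n) (a (s n)) (b (s n)))) Filter.atTop (nhds (∫ x, f x ∂μ))) → ∀ᵐ γ ∂μ, γ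 ∈ carrier D

-- earlier SAWAvoidanceLaw (stmt-CriticalPhenomena-4924, replaced 2026-08-15T16:53:24Z -> stmt-CriticalPhenomena-11195): retired by None — ∀ (D D' : Literature.Probability.RandomPlanarGeometry.DobrushinDomain), D.IsHullSubdomain D' → ∀ (a b : ℝ → Literature.Probability.LatticeModels.Site 2), Literature.Probability.RandomPlanarGeometry.SAW.IsEndpointApprox D a b → ∀ (φ : Literature.Probability.RandomP
/-- item stmt-CriticalPhenomena-11195 · support · rank 9 · open · by planner
sources: LawlerSchrammWerner2004SAW, LawlerSchrammWerner2003Restriction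
[support] (A0, the s = 0 endpoint; first conjunct of X; other routes may target it directly) for
every D, hull subdomain D′, endpoint approximation, chordal uniformizer and restriction data (Φ, d)
of φ.pullbackHull D′: SAW.law(D_δ; a_δ, b_δ){γ uses only vertices of D′ and edges inside cl D′} →
d^(5/8). Obtained here from P and U by VitaliTransport; it is LSW04's restriction prediction made
quantifier-precise. [difficulty: open-problem] [reroute 2026-08-15: `MarkedDomain.IsHullSubdomain`
and `ConformalEquiv.pullbackHull` are inlined as the lets `hull` / `pb` (definitionally equal,
Iff.rfl with the rev-1 text) so that the route imports only `RestrictionHulls` above the Statement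
cone; provers may `show` the folded form after importing HullSubdomainPullback in their Theorems
file.] -/
@[route_item "route-CriticalPhenomena-SAWChargeContinuation"]
def SAWAvoidanceLaw : Prop :=
  let hull : Literature.Probability.RandomPlanarGeometry.DobrushinDomain → Literature.Probability.RandomPlanarGeometry.DobrushinDomain → Prop := fun D D' => D'.carrier ⊆ D.carrier ∧ D'.pt 0 = D.pt 0 ∧ D'.pt 1 = D.pt 1 ∧ D.pt 0 ∉ closure (D.carrier \ D'.carrier) ∧ D.pt 1 ∉ closure (D.carrier \ D'.carrier); let pb : (D : Literature.Probability.RandomPlanarGeometry.DobrushinDomain) → Literature.Probability.RandomPlanarGeometry.ConformalEquiv UpperHalfPlane.upperHalfPlaneSet D.carrier → Literature.Probability.RandomPlanarGeometry.DobrushinDomain → Set ℂ := fun _ φ D' => closure (UpperHalfPlane.upperHalfPlaneSet \ {z | z ∈ UpperHalfPlane.upperHalfPlaneSet ∧ φ z ∈ D'.carrier}); ∀ (D D' : Literature.Probability.RandomPlanarGeometry.DobrushinDomain), hull D D' → ∀ (a b : ℝ → Literature.Probability.LatticeModels.Site 2), Literature.Probability.RandomPlanarGeometry.SAW.IsEndpointApprox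 D a b → ∀ (φ : Literature.Probability.RandomPlanarGeometry.ConformalEquiv UpperHalfPlane.upperHalfPlaneSet D.carrier), D.IsChordalUniformizing φ → ∀ (Φ : Literature.Probability.RandomPlanarGeometry.ConformalEquiv (UpperHalfPlane.upperHalfPlaneSet \ pb D φ D') UpperHalfPlane.upperHalfPlaneSet) (d : ℝ), Literature.Probability.RandomPlanarGeometry.IsRestrictionMap (pb D φ D') Φ → Literature.Probability.RandomPlanarGeometry.HasRestrictionDeriv (pb D φ D') Φ d → Filter.Tendsto (fun δ => (Literature.Probability.RandomPlanarGeometry.SAW.law D.carrier δ (a δ) (b δ) {γ | ∀ e ∈ γ.walk.darts, (Literature.Probability.LatticeModels.meshGraph D'.carrier δ).Adj e.fst e.snd ∧ e.fst ∈ Literature.Probability.LatticeModels.meshVertices D'.carrier δ ∧ e.snd ∈ Literature.Probability.LatticeModels.meshVertices D'.carrier δ}).toReal) (nhdsWithin 0 (Set.Ioi 0)) (nhds (d ^ (5 / 8 : ℝ)))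

-- earlier AnchorExcursion (stmt-CriticalPhenomena-4926, replaced 2026-08-15T16:53:24Z -> stmt-CriticalPhenomena-11196): retired by None — let G : Set ℂ → Set ℂ → ℝ → SimpleGraph (Literature.Probability.LatticeModels.Site 2) := fun Ω Ω' δ => SimpleGraph.fromRel fun x y => (Literature.Probability.LatticeModels.discreteDomainGraph Ω δ).Adj x y ∧ (Literature.Probability.LatticeModels.meshGraph Ω' δ).Adj
/-- item stmt-CriticalPhenomena-11196 · support · rank 9 · open · by planner
sources: Lawler2018, LawlerSchrammWerner2003Restriction, LawlerLimic2010, KozdronLawler2007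
[support] the s = 1, y = 1/4 case of the window: Z(D_δ|D′; 1, 1/4) is the Green's function of the
simple random walk killed outside the D′-sub-graph (Lawler2018 Prop 3.1 with Prop 5.2: Σ_(LE(ω)=η)
4^(−|ω|) = 4^(−|η|) e^(m(η))), so R_δ(1) = P[RW from a_δ conditioned to reach b_δ in D_δ stays in
the D′-sub-graph]·(1+o(1)) → P[Brownian excursion a → b in D avoids D ∖ D′] = Φ_A′(0) = d (LSW03
Prop 4.1, proved in the tree for the Brownian side: exists_isRestrictionMeasure_one_brownianQuad).
[difficulty: L] [reroute 2026-08-15: `MarkedDomain.IsHullSubdomain` and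
`ConformalEquiv.pullbackHull` are inlined as the lets `hull` / `pb` (definitionally equal, Iff.rfl
with the rev-1 text) so that the route imports only `RestrictionHulls` above the Statement cone;
provers may `show` the folded form after importing HullSubdomainPullback in their Theorems file.] -/
@[route_item "route-CriticalPhenomena-SAWChargeContinuation"]
def AnchorExcursion : Prop :=
  let hull : Literature.Probability.RandomPlanarGeometry.DobrushinDomain → Literature.Probability.RandomPlanarGeometry.DobrushinDomain → Prop := fun D D' => D'.carrier ⊆ D.carrier ∧ D'.pt 0 = D.pt 0 ∧ D'.pt 1 = D.pt 1 ∧ D.pt 0 ∉ closure (D.carrier \ D'.carrier) ∧ D.pt 1 ∉ closure (D.carrier \ D'.carrier); let pb : (D : Literature.Probability.RandomPlanarGeometry.DobrushinDomain) → Literature.Probability.RandomPlanarGeometry.ConformalEquiv UpperHalfPlane.upperHalfPlaneSet D.carrier → Literature.Probability.RandomPlanarGeometry.DobrushinDomain → Set ℂ := fun _ φ D' => closure (UpperHalfPlane.upperHalfPlaneSet \ {z | z ∈ UpperHalfPlane.upperHalfPlaneSet ∧ φ z ∈ D'.carrier}); let G : Set ℂ → Set ℂ → ℝ → SimpleGraph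 (Literature.Probability.LatticeModels.Site 2) := fun Ω Ω' δ => SimpleGraph.fromRel fun x y => (Literature.Probability.LatticeModels.discreteDomainGraph Ω δ).Adj x y ∧ (Literature.Probability.LatticeModels.meshGraph Ω' δ).Adj x y ∧ x ∈ Literature.Probability.LatticeModels.meshVertices Ω' δ ∧ y ∈ Literature.Probability.LatticeModels.meshVertices Ω' δ; let m : (Ω Ω' : Set ℂ) → (δ : ℝ) → (a b : Literature.Probability.LatticeModels.Site 2) → Literature.Probability.RandomPlanarGeometry.SAW.DomainSAW Ω δ a b → ℝ := fun Ω Ω' δ _ _ γ => ∑' p : (Σ x : Literature.Probability.LatticeModels.Site 2, (G Ω Ω' δ).Walk x x), if 0 < p.2.length ∧ (∃ v ∈ p.2.support, v ∈ γ.walk.support) then (1 / 4 : ℝ) ^ p.2.length / (p.2.length : ℝ) else 0; let Z : (Ω Ω' : Set ℂ) → (δ : ℝ) → (a b : Literature.Probability.LatticeModels.Site 2) → ℂ → ℂ → ℂ := fun Ω Ω' δ a b s y => ∑' γ : Literature.Probability.RandomPlanarGeometry.SAW.DomainSAW Ω δ a b, if (∀ e ∈ γ.walk.darts, (G Ω Ω'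 δ).Adj e.fst e.snd) then y ^ γ.length * Complex.exp (s * (m Ω Ω' δ a b γ : ℂ)) else 0; ∀ (D D' : Literature.Probability.RandomPlanarGeometry.DobrushinDomain), hull D D' → ∀ (a b : ℝ → Literature.Probability.LatticeModels.Site 2), Literature.Probability.RandomPlanarGeometry.SAW.IsEndpointApprox D a b → ∀ (φ : Literature.Probability.RandomPlanarGeometry.ConformalEquiv UpperHalfPlane.upperHalfPlaneSet D.carrier), D.IsChordalUniformizing φ → ∀ (Φ : Literature.Probability.RandomPlanarGeometry.ConformalEquiv (UpperHalfPlane.upperHalfPlaneSet \ pb D φ D') UpperHalfPlane.upperHalfPlaneSet) (d : ℝ), Literature.Probability.RandomPlanarGeometry.IsRestrictionMap (pb D φ D') Φ → Literature.Probability.RandomPlanarGeometry.HasRestrictionDeriv (pb D φ D') Φ d → Filter.Tendsto (fun δ => Z D.carrier D'.carrier δ (a δ) (b δ) 1 (1 / 4) / Z D.carrier D.carrier δ (a δ) (b δ) 1 (1 / 4)) (nhdsWithin 0 (Set.Ioi 0)) (nhds (d : ℂ))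

-- earlier RestrictionIdentification (stmt-CriticalPhenomena-4927, replaced 2026-08-15T16:53:24Z -> stmt-CriticalPhenomena-11197): retired by None — ∀ (D : Literature.Probability.RandomPlanarGeometry.DobrushinDomain) (μ : MeasureTheory.Measure (Literature.Probability.RandomPlanarGeometry.CurveClass ℂ)), MeasureTheory.IsProbabilityMeasure μ → (∀ᵐ γ ∂μ, γ ∈ Literature.Probability.RandomPlanarGeometry.c
/-- item stmt-CriticalPhenomena-11197 · support · rank 9 · closed · proved by Summit.CriticalPhenomena.SAWScalingLimit.Theorems.RestrictionIdentification_proof (prover) · by planner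
sources: LawlerSchrammWerner2003Restriction, RohdeSchramm2005
[support] LSW identification from avoidance numbers: a probability law μ on CurveClass ℂ carried by
chordalCarrier D whose masses of {range ⊆ cl D′} equal d^(5/8) for all hull subdomains D′ (d =
Φ_A′(0), A = φ.pullbackHull D′) is the chordal SLE_8/3 law of D. Proof sketch: pull back by φ
(RestrictionPullback), extend the formula from pull-back hulls of Jordan hull subdomains to all
*-hulls (exists_antitone_isArcHull_holds, monotone continuity), get IsRestrictionMeasure (5/8),
apply IsRestrictionMeasure.eq_map_sleTrace_eightThirds (hasSLETrace_eightThirds,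
sle_restriction_eightThirds_holds) and return to D as in RestrictionUniqueness
(ext_of_missCode_injOn). [difficulty: L] [reroute 2026-08-15: `MarkedDomain.IsHullSubdomain` and
`ConformalEquiv.pullbackHull` are inlined as the lets `hull` / `pb` (definitionally equal, Iff.rfl
with the rev-1 text) so that the route imports only `RestrictionHulls` above the Statement cone;
provers may `show` the folded form after importing HullSubdomainPullback in their Theorems file.]
[reroute 2026-08-15: `chordalCarrier D` is inlined as the let `carrier` (= CurveClass.simple ∩
source/target = a,b ∩ range ⊆ D ∪ {a,b}; definitionally `chordalCarrier`, -/
@[route_item "route-CriticalPhenomena-SAWChargeContinuation", crux]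
def RestrictionIdentification : Prop :=
  let hull : Literature.Probability.RandomPlanarGeometry.DobrushinDomain → Literature.Probability.RandomPlanarGeometry.DobrushinDomain → Prop := fun D D' => D'.carrier ⊆ D.carrier ∧ D'.pt 0 = D.pt 0 ∧ D'.pt 1 = D.pt 1 ∧ D.pt 0 ∉ closure (D.carrier \ D'.carrier) ∧ D.pt 1 ∉ closure (D.carrier \ D'.carrier); let pb : (D : Literature.Probability.RandomPlanarGeometry.DobrushinDomain) → Literature.Probability.RandomPlanarGeometry.ConformalEquiv UpperHalfPlane.upperHalfPlaneSet D.carrier → Literature.Probability.RandomPlanarGeometry.DobrushinDomain → Set ℂ := fun _ φ D' => closure (UpperHalfPlane.upperHalfPlaneSet \ {z | z ∈ UpperHalfPlane.upperHalfPlaneSet ∧ φ z ∈ D'.carrier}); let carrier : Literature.Probability.RandomPlanarGeometry.DobrushinDomain → Set (Literature.Probability.RandomPlanarGeometry.CurveClass ℂ) := fun D => Literature.Probability.RandomPlanarGeometry.CurveClass.simple ∩ {c | c.source = D.pt 0} ∩ {c | c.target = D.pt 1} ∩ {c | c.range ⊆ D.carrier ∪ {D.pt 0, D.pt 1}}; ∀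 (D : Literature.Probability.RandomPlanarGeometry.DobrushinDomain) (μ : MeasureTheory.Measure (Literature.Probability.RandomPlanarGeometry.CurveClass ℂ)), MeasureTheory.IsProbabilityMeasure μ → (∀ᵐ γ ∂μ, γ ∈ carrier D) → (∀ (D' : Literature.Probability.RandomPlanarGeometry.DobrushinDomain), hull D D' → ∀ (φ : Literature.Probability.RandomPlanarGeometry.ConformalEquiv UpperHalfPlane.upperHalfPlaneSet D.carrier), D.IsChordalUniformizing φ → ∀ (Φ : Literature.Probability.RandomPlanarGeometry.ConformalEquiv (UpperHalfPlane.upperHalfPlaneSet \ pb D φ D') UpperHalfPlane.upperHalfPlaneSet) (d : ℝ), Literature.Probability.RandomPlanarGeometry.IsRestrictionMap (pb D φ D') Φ → Literature.Probability.RandomPlanarGeometry.HasRestrictionDeriv (pb D φ D') Φ d → μ (Literature.Probability.RandomPlanarGeometry.CurveClass.rangeSubset (closure D'.carrier)) = ENNReal.ofReal (d ^ (5 / 8 : ℝ))) → Literature.Probability.RandomPlanarGeometry.IsSLELaw ((8 : NNReal) / 3) D μ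

-- earlier AvoidanceOfLimit (stmt-CriticalPhenomena-4928, replaced 2026-08-15T16:53:24Z -> stmt-CriticalPhenomena-11198): retired by None — SAWAvoidanceLaw → ∀ (D : Literature.Probability.RandomPlanarGeometry.DobrushinDomain) (a b : ℝ → Literature.Probability.LatticeModels.Site 2), Literature.Probability.RandomPlanarGeometry.SAW.IsEndpointApprox D a b → ∀ (s : ℕ → ℝ) (μ : MeasureTheory.Measure (Liter
/-- item stmt-CriticalPhenomena-11198 · support · rank 9 · closed · proved by Summit.CriticalPhenomena.SAWScalingLimit.Theorems.AvoidanceOfLimit.avoidanceOfLimit_proof (prover) · by planner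
sources: LawlerSchrammWerner2004SAW, LawlerSchrammWerner2003Restriction
[support] glue: SAWAvoidanceLaw ⇒ every subsequential weak limit μ of the SAW laws in D gives mass
d^(5/8) to {range ⊆ cl D′} for every hull subdomain D′ with restriction data (φ, Φ, d). Sandwich by
portmanteau: the lattice event for D′ forces the polyline into cl D′ (closed event, limsup), and
{range ⊆ U}, U = ℂ ∖ cl(D ∖ D‴) open, forces the lattice event for an inner hull subdomain D‴;
continuity of Φ_A′(0) under inner exhaustion of A closes the gap. No simplicity needed. [difficulty:
M] [reroute 2026-08-15: `MarkedDomain.IsHullSubdomain` and `ConformalEquiv.pullbackHull` are inlined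
as the lets `hull` / `pb` (definitionally equal, Iff.rfl with the rev-1 text) so that the route
imports only `RestrictionHulls` above the Statement cone; provers may `show` the folded form after
importing HullSubdomainPullback in their Theorems file.] -/
@[route_item "route-CriticalPhenomena-SAWChargeContinuation", crux]
def AvoidanceOfLimit : Prop :=
  let hull : Literature.Probability.RandomPlanarGeometry.DobrushinDomain → Literature.Probability.RandomPlanarGeometry.DobrushinDomain → Prop := fun D D' => D'.carrier ⊆ D.carrier ∧ D'.pt 0 = D.pt 0 ∧ D'.pt 1 = D.pt 1 ∧ D.pt 0 ∉ closure (D.carrier \ D'.carrier) ∧ D.pt 1 ∉ closure (D.carrier \ D'.carrier); let pb : (D : Literature.Probability.RandomPlanarGeometry.DobrushinDomain) → Literature.Probability.RandomPlanarGeometry.ConformalEquiv UpperHalfPlane.upperHalfPlaneSet D.carrier → Literature.Probability.RandomPlanarGeometry.DobrushinDomain → Set ℂ := fun _ φ D' => closure (UpperHalfPlane.upperHalfPlaneSet \ {z | z ∈ UpperHalfPlane.upperHalfPlaneSet ∧ φ z ∈ D'.carrier}); SAWAvoidanceLaw → ∀ (D : Literature.Probability.RandomPlanarGeometry.DobrushinDomain)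 (a b : ℝ → Literature.Probability.LatticeModels.Site 2), Literature.Probability.RandomPlanarGeometry.SAW.IsEndpointApprox D a b → ∀ (s : ℕ → ℝ) (μ : MeasureTheory.Measure (Literature.Probability.RandomPlanarGeometry.CurveClass ℂ)), Filter.Tendsto s Filter.atTop (nhdsWithin 0 (Set.Ioi 0)) → MeasureTheory.IsProbabilityMeasure μ → (∀ f : BoundedContinuousFunction (Literature.Probability.RandomPlanarGeometry.CurveClass ℂ) ℝ, Filter.Tendsto (fun n => ∫ γ, f γ.curve ∂(Literature.Probability.RandomPlanarGeometry.SAW.law D.carrier (s n) (a (s n)) (b (s n)))) Filter.atTop (nhds (∫ x, f x ∂μ))) → ∀ (D' : Literature.Probability.RandomPlanarGeometry.DobrushinDomain), hull D D' → ∀ (φ : Literature.Probability.RandomPlanarGeometry.ConformalEquiv UpperHalfPlane.upperHalfPlaneSet D.carrier), D.IsChordalUniformizing φ → ∀ (Φ : Literature.Probability.RandomPlanarGeometry.ConformalEquiv (UpperHalfPlane.upperHalfPlaneSet \ pb D φ D') UpperHalfPlane.upperHalfPlaneSet) (d : ℝ), Literature.Probability.RandomPlanarGeometry.IsRestrictionMap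 (pb D φ D') Φ → Literature.Probability.RandomPlanarGeometry.HasRestrictionDeriv (pb D φ D') Φ d → μ (Literature.Probability.RandomPlanarGeometry.CurveClass.rangeSubset (closure D'.carrier)) = ENNReal.ofReal (d ^ (5 / 8 : ℝ))

/-- item stmt-CriticalPhenomena-14196 · support · rank 9 · closed · proved by Summit.CriticalPhenomena.SAWScalingLimit.Theorems.targetOfConjuncts_proof (prover) · by planner
[support] glue (route-choice repair 2026-08-16, target-unreachable): the Target X = (A0) ∧ (T) ∧ (S)
is concluded from its three conjuncts — SAWAvoidanceLaw (A0, reached from the cruxes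
WindowAvoidanceLaw and ChargeAnalyticity by VitaliTransport), EventualTight (T, crux rank 4) and
SubseqSimple (S, crux rank 5). Bookkeeping, provable now by And.intro: `Target` unfolds
(zeta/delta-reduction of the inlined lets `hull`/`pb`/`carrier`) to `SAWAvoidanceLaw ∧ EventualTight
∧ SubseqSimple` (checked in the planner Sketch.lean: `fun h₁ h₂ h₃ => ⟨h₁, h₂, h₃⟩`, axioms
propext/Classical.choice/Quot.sound). Chain of items: WindowAvoidanceLaw → ChargeAnalyticity
→(VitaliTransport) SAWAvoidanceLaw →(TargetOfConjuncts, with EventualTight, SubseqSimple) Target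
→(AssemblyTarget, with RestrictionIdentification, AvoidanceOfLimit) SAWScalingLimit. [difficulty:
XS] [LawlerSchrammWerner2004SAW] -/
@[route_item "route-CriticalPhenomena-SAWChargeContinuation", crux]
def TargetOfConjuncts : Prop :=
  SAWAvoidanceLaw → EventualTight → SubseqSimple → Target

/-- item stmt-CriticalPhenomena-4925 · support · rank 9 · closed · proved by Summit.CriticalPhenomena.SAWScalingLimit.Theorems.chargeContinuation_vitaliTransport_proof (prover) · by planner
sources: KozdronLawler2007, LawlerSchrammWerner2003Restriction
[support] glue: WindowAvoidanceLaw → ChargeAnalyticity → SAWAvoidanceLaw. Fix (D, D′, a, b, φ, Φ,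
d); the g_δ of U are holomorphic on N and bounded by C, converge on the real window to d^α(s) (P),
hence (Vitali–Porter / Montel + identity theorem) converge locally uniformly on the component to the
continuation of d^α(s), which at s = 0 is d^(5/8); and g_δ(0) = R_δ(0, x_c) = the SAW probability of
the event in SAWAvoidanceLaw (Z at s = 0 is the x_c^|γ|-sum). [difficulty: M] -/
@[route_item "route-CriticalPhenomena-SAWChargeContinuation", crux]
def VitaliTransport : Prop :=
  WindowAvoidanceLaw → ChargeAnalyticity → SAWAvoidanceLaw

/-- item stmt-CriticalPhenomena-4929 · support · rank 9 · closed · proved by Summit.CriticalPhenomena.SAWScalingLimit.Theorems.chargeContinuation_assemblyTarget_proof (prover) · by planner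
sources: LawlerSchrammWerner2004SAW, KemppainenSmirnov2017
[support] RestrictionIdentification → AvoidanceOfLimit → Target → SAWScalingLimit: laws are
eventually probability measures (IsEndpointApprox.reachable; DomainSAW finite); EventualTight +
Prokhorov (CurveClass ℂ Polish, polishSpace_holds) give subsequential limits along any δ_n → 0⁺;
SubseqSimple puts them on chordalCarrier D; AvoidanceOfLimit + RestrictionIdentification make each
the SLE_8/3 law, unique (IsSLECurve.map_eq via identDistrib_sleTrace_scale_holds) and realised
(exists_isSLECurve_of_ne_eight); the subsequence principle along the first-countable filter 𝓝[>]0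
yields ConvergesInLawToSLE (8/3). [difficulty: M] -/
@[route_item "route-CriticalPhenomena-SAWChargeContinuation", crux]
def AssemblyTarget : Prop :=
  RestrictionIdentification → AvoidanceOfLimit → Target → SAWScalingLimit

/-- item stmt-CriticalPhenomena-4930 · assembly · rank 1 · closed · proved by Summit.CriticalPhenomena.SAWScalingLimit.Theorems.chargeContinuation_assembly_proof (prover) · by planner
sources: LawlerSchrammWerner2003Restriction, KozdronLawler2007
[assembly] RestrictionIdentification → AvoidanceOfLimit → VitaliTransport → WindowAvoidanceLaw →
ChargeAnalyticity → EventualTight → SubseqSimple → SAWScalingLimit. -/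
@[route_item "route-CriticalPhenomena-SAWChargeContinuation"]
def Assembly : Prop :=
  RestrictionIdentification → AvoidanceOfLimit → VitaliTransport → WindowAvoidanceLaw → ChargeAnalyticity → EventualTight → SubseqSimple → SAWScalingLimit

/-! D-0027 §2.1 — DECIDING THEOREM (planner-authored via `route open/edit --closes-file`; by planner-rchoice-CriticalPhenomena-SAWChargeCon-86a1fede-0 2026-08-16T03:16:28Z):
its hypotheses are this route's items and its conclusion the sub-problem Statement (glue_lint), and it elaborates with this file. -/

@[closes "route-CriticalPhenomena-SAWChargeContinuation"] theorem closes (hRI : RestrictionIdentification) (hAL : AvoidanceOfLimit)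
    (hVT : VitaliTransport) (hP : WindowAvoidanceLaw) (hU : ChargeAnalyticity)
    (hT : EventualTight) (hS : SubseqSimple) (hTC : TargetOfConjuncts)
    (hAT : AssemblyTarget) : _root_.SAWScalingLimit :=
  hAT hRI hAL (hTC (hVT hP hU) hT hS)

end Summit.CriticalPhenomena.SAWScalingLimit.Theses.SAWChargeContinuation
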